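import Literature.Analysis.PDE.ABPPointwise
import Literature.Analysis.PDE.ABPNormalMapping
import HarnessLib

/-!
# The Aleksandrov–Bakelman–Pucci estimate (Gilbarg–Trudinger, Lemma 9.3 / Thm. 9.1, `b = c = 0`)

Measure form of the ABP maximum principle for `Lu = a^{ij}D_{ij}u` with positive definite
coefficients: for a bounded open `Ω`, `u` continuous on `Ω̄`, `C¹` on `Ω` with `Du`
differentiable and `D²u` symmetric on `Ω`, `u ≤ 0` on `∂Ω` and `x₀ ∈ Ω`,

`μ(B(0, u(x₀)/diam Ω̄)) ≤ ∫_{Γ⁺} ((−a^{ij}D_{ij}u)/n)ⁿ / det a dμ`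

(`addHaar_ball_le_lintegral_abp`). With `μ = ℒⁿ`, `μ(B(0,r)) = ω_n rⁿ` and `−a^{ij}D_{ij}u ≤ (Lu)⁻`
this is Gilbarg–Trudinger's `sup_Ω u ≤ sup_{∂Ω} u⁺ + (d/(n ω_n^{1/n})) ‖(a^{ij}D_{ij}u)⁻/𝒟*‖_{Lⁿ(Γ⁺)}`,
`𝒟* = (det a)^{1/n}` ((9.11) with `b = 0`). Assembled from the normal-mapping inequality
(`addHaar_ball_le_lintegral_det_upperContactSet`, Lemma 9.2), `det D(∇u) = det D²u`
(`det_fderiv_gradient_eq`) and the pointwise bound `det a·|det D²u| ≤ ((−a^{ij}D_{ij}u)/n)ⁿ` on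
`Γ⁺` (`det_coeff_mul_abs_det_hessian_le`, Lemma 9.3).

## References

* D. Gilbarg, N. S. Trudinger, *Elliptic Partial Differential Equations of Second Order* (2001),
  §9.1, Lemma 9.3 and Thm. 9.1 ((9.11), (9.14) with `b = 0`, `c = 0`). [GilbargTrudinger2001]
-/

noncomputable section

open Set Metric MeasureTheory Matrix Finset
open scoped ENNReal MatrixOrder

namespace Literature.Analysis.PDE.ABP

variable {E : Type*} [NormedAddCommGroup E] [InnerProductSpace ℝ E] [FiniteDimensional ℝ E]
  [MeasurableSpace E] [BorelSpace E] {ι : Type*} [Fintype ι] [DecidableEq ι] [Nonempty ι]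

omit [MeasurableSpace E] [BorelSpace E] in
/-- **The pointwise integrand bound on `Γ⁺`**: with `det a > 0`,
`|det D(∇u)(y)| ≤ ((−Σ a_{ij}H_{ij})/n)ⁿ / det a`. [cite: GilbargTrudinger2001, §9.1, Lemma 9.3] -/
theorem abs_det_fderiv_gradient_le {Ω : Set E} (hΩo : IsOpen Ω) {u : E → ℝ}
    (hdiff : ∀ x ∈ Ω, DifferentiableAt ℝ u x) {y : E} (hy : y ∈ upperContactSet u Ω)
    (hD2 : DifferentiableAt ℝ (fderiv ℝ u) y)
    (hsymm : ∀ v w, fderiv ℝ (fderiv ℝ u) y v w = fderiv ℝ (fderiv ℝ u) y w v)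
    (b : OrthonormalBasis ι ℝ E) {a : Matrix ι ι ℝ} (ha : a.PosDef) :
    |(fderiv ℝ (gradient u) y).det| ≤
      ((-∑ i, ∑ j, a i j * hessianMatrix u b y i j) / Fintype.card ι) ^ Fintype.card ι / a.det := by
  haveI : CompleteSpace E := FiniteDimensional.complete ℝ E
  have hdet : 0 < a.det := ha.det_pos
  rw [det_fderiv_gradient_eq hD2 b, le_div_iff₀ hdet, mul_comm]
  exact det_coeff_mul_abs_det_hessian_le hΩo hdiff hy hD2 hsymm b ha.posSemidef

/-- **The Aleksandrov–Bakelman–Pucci estimate (measure form, `b = c = 0`).** For a bounded open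
`Ω`, `u` continuous on `Ω̄`, differentiable on `Ω` with `∇u` continuous and `Du` differentiable on
`Ω` and `D²u` symmetric there, `u ≤ 0` on `∂Ω`, `x₀ ∈ Ω`, `diam Ω̄ > 0`, and a positive definite
coefficient field `a` on `Ω`: for every additive Haar measure `μ`,
`μ(B(0, u(x₀)/diam Ω̄)) ≤ ∫_{Γ⁺} ((−Σ_{ij} a_{ij}(y) D²u(y)(b_i,b_j))/n)ⁿ / det a(y) dμ(y)`.
[cite: GilbargTrudinger2001, §9.1, Lemma 9.3 and Thm. 9.1] -/
theorem addHaar_ball_le_lintegral_abp (μ : Measure E) [μ.IsAddHaarMeasure] {Ω : Set E}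
    (hΩo : IsOpen Ω) (hΩb : Bornology.IsBounded Ω) {u : E → ℝ}
    (hu : ContinuousOn u (closure Ω)) (hdiff : ∀ y ∈ Ω, DifferentiableAt ℝ u y)
    (hgu : ContinuousOn (gradient u) Ω) (hD2f : ∀ y ∈ Ω, DifferentiableAt ℝ (fderiv ℝ u) y)
    (hsymm : ∀ y ∈ Ω, ∀ v w, fderiv ℝ (fderiv ℝ u) y v w = fderiv ℝ (fderiv ℝ u) y w v)
    (hbd : ∀ y ∈ frontier Ω, u y ≤ 0) {x₀ : E} (hx₀ : x₀ ∈ Ω) (hd : 0 < diam (closure Ω))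
    (b : OrthonormalBasis ι ℝ E) {a : E → Matrix ι ι ℝ} (ha : ∀ y ∈ Ω, (a y).PosDef) :
    μ (ball (0 : E) (u x₀ / diam (closure Ω))) ≤
      ∫⁻ y in upperContactSet u Ω, ENNReal.ofReal
        (((-∑ i, ∑ j, a y i j * hessianMatrix u b y i j) / Fintype.card ι) ^ Fintype.card ι /
          (a y).det) ∂μ := by
  haveI : CompleteSpace E := FiniteDimensional.complete ℝ E
  -- `∇u` is differentiable where `Du` is (composition with the Riesz isometry)
  have hD2 : ∀ y ∈ Ω, DifferentiableAt ℝ (gradient u) y := fun y hy ↦ by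
    have hg : gradient u = fun x ↦ (InnerProductSpace.toDual ℝ E).symm (fderiv ℝ u x) := by
      funext x; rfl
    rw [hg]
    exact (InnerProductSpace.toDual ℝ E).symm.toContinuousLinearEquiv.differentiableAt.comp y
      (hD2f y hy)
  have h92 := addHaar_ball_le_lintegral_det_upperContactSet μ hΩo hΩb hu hdiff hgu hD2 hbd hx₀ hd
  refine h92.trans (setLIntegral_mono' ?_ fun y hy ↦ ?_)
  · exact measurableSet_upperContactSet hΩo (hu.mono subset_closure) hgu
  · exact ENNReal.ofReal_le_ofReal
      (abs_det_fderiv_gradient_le hΩo hdiff hy (hD2f y hy.1) (hsymm y hy.1) b (ha y hy.1))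

end Literature.Analysis.PDE.ABP

end
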